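import Literature.Analysis.ValidatedNumerics.TaylorModelLog
import Literature.Analysis.ValidatedNumerics.MultiPrecisionBall
import Mathlib.Analysis.SpecialFunctions.Trigonometric.Basic
import HarnessLib

/-!
# Taylor models of `sin ∘ g` and `cos ∘ g` for a Taylor-modelled `g` (trigonometric intrinsics by the addition theorems)

Trunk T-ANA (Analysis/ValidatedNumerics); namespace `Literature.Analysis.ValidatedNumerics.PolyMP`.
Sequel of `TaylorModelLog.lean` (which supplies `log ∘ g` and `exp ∘ g`) in the same Makino–Berz / Joldeş `TMComp`
form "split off the constant part, expand the rest": for a Taylor model `G` of `g` on `|ρ| ≤ h` with rational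
midpoint `c = mid0 S G` of its constant coefficient and `u = g − c`,

  `sin g = sin c · cos u + cos c · sin u`,   `cos g = cos c · cos u − sin c · sin u`,

where

* the POINT VALUES `(cos c, sin c)` come from `cisPt S Kt kt (ofRat S c)` — an enclosure of `e^{ix}` for `x` in a
  real interval `X` WITHOUT argument reduction (so no enclosure of `π` is threaded through a certificate checker):
  the Taylor polynomial of `e^{iφ}` on `φ ∈ X/2^{kt}` (`MC.expISmallPt`, `Kt` terms, accepted only if
  `X/2^{kt} ⊆ [−1, 1]`) followed by `kt` complex squarings (`MC.sqrIter`), `mem_cisPt`; `cos x ∈ re`, `sin x ∈ im`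
  (`mem_cos_of_cisPt`, `mem_sin_of_cisPt`);
* the SMALL-ARGUMENT compositions `tcosCompI S h D K U` / `tsinCompI S h D K U` (`tmem_cosComp`, `tmem_sinComp`) are
  Horner evaluations IN `w = u²` of the even Taylor polynomials `Σ_{l<K} (−1)^l w^l/(2l)!` and
  `u · Σ_{l<K} (−1)^l w^l/(2l+1)!` in Taylor-model arithmetic, with the common remainder
  `|u|^{2K} (2K+1)/((2K)!·2K)` (`|u| ≤ 1`, from `Complex.exp_bound` through
  `NumericsMP.FB.cos_sin_taylor_remainder`) folded into the constant coefficient, the range bound being certified by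
  `|u|·S ≤ tabsI S h U ≤ S`;
* `tsinTM S h D K Kt kt G` / `tcosTM S h D K Kt kt G` return the model together with its ACCEPTANCE FLAG
  (`0 < K`, `tabsI S h U ≤ S`, point evaluation accepted), so that a certificate checker can conjoin it:
  `tmem_sin_of_tsinTM`, `tmem_cos_of_tcosTM`.

Problem-independent plumbing for kernel-checked integral certificates with trigonometric integrands; no facts,
no axioms.

## References

* M. Joldeş, *Rigorous Polynomial Approximations and Applications*, PhD thesis, ENS Lyon (2011): Section 2.2.1
  (Taylor models of basic functions — `sin`, `cos` among them — by Taylor–Lagrange coefficients and remainder,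
  thesis pp. 50–52) and Algorithm 2.2.8 `TMComp` (composition of a Taylor model with a basic function: split off
  the constant coefficient, model the basic function around it over the bound of the argument, compose by
  polynomial evaluation of the shifted model, thesis p. 60). [cite: Joldes2011, Algorithm 2.2.8]
* K. Makino, M. Berz, *Taylor models and other validated functional inclusion methods*, Int. J. Pure Appl.
  Math. 4 (2003) 379–456 (Taylor-model intrinsics by addition theorems; `sin`/`cos` eq. (2.10)–(2.11)).
  [cite: MakinoBerz2003, passim]
* R. P. Brent, P. Zimmermann, *Modern Computer Arithmetic*, Cambridge Univ. Press (2010), §4.3.1 (repeated use of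
  a doubling formula: `exp x = exp(x/2^k)^(2^k)`, `k` squarings, p. 134) and §4.8.5 (`cos x + i sin x = exp(ix)`,
  p. 163). [cite: BrentZimmermann2010, §4.3.1]
* The series of `e^{iφ}` with remainder (Mathlib `Complex.exp_bound`) split into its real and imaginary parts
  (`NumericsMP.FB.cos_sin_taylor_remainder` of `MultiPrecisionBall.lean`). [folklore]
-/

namespace Literature.Analysis.ValidatedNumerics

namespace PolyMP

open Literature.Analysis.ValidatedNumerics.NumericsMP
open Literature.Analysis.ValidatedNumerics.ExpPoly (Poly)

/-! ### Point values `e^{ix}`, `cos x`, `sin x` without argument reduction -/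

/-- Enclosure of `e^{ix}` for `x ∈ X`: the Taylor polynomial of `e^{iφ}`, `φ ∈ X/2^k` (`MC.expISmallPt`, `K` terms;
`none` unless `X/2^k ⊆ [−1, 1]` and `0 < K`), then `k` complex squarings — the doubling scheme
`exp z = exp(z/2^k)^(2^k)` at `z = ix`. [cite: BrentZimmermann2010, §4.3.1] -/
def cisPt (S K k : ℕ) (X : MI) : Option MC :=
  match MC.expISmallPt S K (X.divNat (2 ^ k)) with
  | some A => some (MC.sqrIter S k A)
  | none => none

/-- **Soundness of `cisPt`**: `e^{ix} ∈ cisPt S K k X` for `x ∈ X` (`exp z = exp(z/2^k)^(2^k)`).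
[cite: BrentZimmermann2010, §4.3.1] -/
theorem mem_cisPt {S : ℕ} (hS : 0 < S) {K k : ℕ} {X : MI} {x : ℝ} {Y : MC} (h : cisPt S K k X = some Y)
    (hx : MI.mem S x X) : MC.mem S (Complex.exp ((x : ℂ) * Complex.I)) Y := by
  unfold cisPt at h
  rcases hA : MC.expISmallPt S K (X.divNat (2 ^ k)) with _ | A
  · simp [hA] at h
  · simp only [hA, Option.some.injEq] at h
    subst h
    have hφ : MI.mem S (x / ((2 ^ k : ℕ) : ℝ)) (X.divNat (2 ^ k)) := MI.mem_divNat hx (by positivity)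
    have h1 := MC.mem_expISmallPt hS hA hφ
    have h2 := MC.mem_sqrIter hS k h1
    have hpow : (Complex.exp (((x / ((2 ^ k : ℕ) : ℝ) : ℝ) : ℂ) * Complex.I)) ^ (2 ^ k) =
        Complex.exp ((x : ℂ) * Complex.I) := by
      rw [← Complex.exp_nat_mul]
      congr 1
      push_cast
      field_simp
    rw [hpow] at h2
    exact h2

/-- `cos x ∈ (cisPt S K k X).re` (`cos x + i sin x = exp(ix)`). [cite: BrentZimmermann2010, §4.8.5] -/
theorem mem_cos_of_cisPt {S : ℕ} (hS : 0 < S) {K k : ℕ} {X : MI} {x : ℝ} {Y : MC} (h : cisPt S K k X = some Y)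
    (hx : MI.mem S x X) : MI.mem S (Real.cos x) Y.re := by
  simpa [Complex.exp_ofReal_mul_I_re] using (mem_cisPt hS h hx).1

/-- `sin x ∈ (cisPt S K k X).im` (`cos x + i sin x = exp(ix)`). [cite: BrentZimmermann2010, §4.8.5] -/
theorem mem_sin_of_cisPt {S : ℕ} (hS : 0 < S) {K k : ℕ} {X : MI} {x : ℝ} {Y : MC} (h : cisPt S K k X = some Y)
    (hx : MI.mem S x X) : MI.mem S (Real.sin x) Y.im := by
  simpa [Complex.exp_ofReal_mul_I_im] using (mem_cisPt hS h hx).2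

/-! ### `cos ∘ u` and `sin ∘ u` for a small Taylor-modelled `u` -/

/-- Coefficients `(−1)^l/(2l)!`, `l < K`, of `cos u` as a polynomial in `w = u²`. [folklore] -/
def cosHalfCoeffs (K : ℕ) : List ℚ := (List.range K).map fun l : ℕ => (-1 : ℚ) ^ l / ((2 * l).factorial : ℚ)

/-- Coefficients `(−1)^l/(2l+1)!`, `l < K`, of `sin u / u` as a polynomial in `w = u²`. [folklore] -/
def sinHalfCoeffs (K : ℕ) : List ℚ := (List.range K).map fun l : ℕ => (-1 : ℚ) ^ l / ((2 * l + 1).factorial : ℚ)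

/-- `P_cos(u²) = Σ_{l<K} (−1)^l u^{2l}/(2l)!`. [folklore] -/
private theorem eval_cosHalfCoeffs_sq (K : ℕ) (u : ℝ) :
    Poly.eval (cosHalfCoeffs K) (u * u) = ∑ l ∈ Finset.range K, (-1 : ℝ) ^ l * u ^ (2 * l) / (2 * l).factorial := by
  rw [cosHalfCoeffs, poly_eval_map_range]
  refine Finset.sum_congr rfl fun l _ => ?_
  rw [← sq, ← pow_mul]
  push_cast
  ring

/-- `u · P_sin(u²) = Σ_{l<K} (−1)^l u^{2l+1}/(2l+1)!`. [folklore] -/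
private theorem mul_eval_sinHalfCoeffs_sq (K : ℕ) (u : ℝ) :
    u * Poly.eval (sinHalfCoeffs K) (u * u) =
      ∑ l ∈ Finset.range K, (-1 : ℝ) ^ l * u ^ (2 * l + 1) / (2 * l + 1).factorial := by
  rw [sinHalfCoeffs, poly_eval_map_range, Finset.mul_sum]
  refine Finset.sum_congr rfl fun l _ => ?_
  rw [← sq, ← pow_mul, pow_succ]
  push_cast
  ring

/-- Scaled remainder bound `⌈S (B/S)^{2K} (2K+1)/((2K)!·2K)⌉` from a scaled range bound `B` (`|u| S ≤ B ≤ S`), common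
to `cos` and `sin`. [folklore] -/
def ttrigCompRem (S : ℕ) (B : ℤ) (K : ℕ) : ℤ :=
  ⌈(S : ℚ) * (((B : ℚ) / S) ^ (2 * K) * ((2 * K + 1 : ℚ) / (((2 * K).factorial : ℚ) * (2 * K))))⌉

/-- The Taylor model of `ρ ↦ cos (u ρ)` for a small `u`: Horner on `cosHalfCoeffs K` at the model of `u²`, plus the
remainder. [cite: Joldes2011, Section 2.2.1] -/
def tcosCompI (S : ℕ) (h : ℚ) (D K : ℕ) (U : IPoly) : IPoly :=
  widen0 (thornerI S h D (cosHalfCoeffs K) (tmulI S h D U U)) (ttrigCompRem S (tabsI S h U) K)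

/-- The Taylor model of `ρ ↦ sin (u ρ)` for a small `u`: `U ·` Horner on `sinHalfCoeffs K` at the model of `u²`,
plus the remainder. [cite: Joldes2011, Section 2.2.1] -/
def tsinCompI (S : ℕ) (h : ℚ) (D K : ℕ) (U : IPoly) : IPoly :=
  widen0 (tmulI S h D U (thornerI S h D (sinHalfCoeffs K) (tmulI S h D U U))) (ttrigCompRem S (tabsI S h U) K)

/-- The scaled remainder estimate shared by `tmem_cosComp` and `tmem_sinComp`. [folklore] -/
private theorem trig_rem_scaled {S : ℕ} (hS : 0 < S) {B : ℤ} {K : ℕ} {u r : ℝ} (huB : |u| ≤ (B : ℝ) / S)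
    (hr : |r| ≤ |u| ^ (2 * K) * ((2 * K + 1) / ((2 * K).factorial * (2 * K)))) :
    |r| * S ≤ (ttrigCompRem S B K : ℝ) := by
  have hSr : (0 : ℝ) < S := by exact_mod_cast hS
  have h2 : |u| ^ (2 * K) ≤ ((B : ℝ) / S) ^ (2 * K) := pow_le_pow_left₀ (abs_nonneg _) huB _
  have hc : (0 : ℝ) ≤ (2 * K + 1 : ℝ) / (((2 * K).factorial : ℝ) * (2 * K)) := by positivity
  have h3 := hr.trans (mul_le_mul_of_nonneg_right h2 hc)
  have h4 : ((S : ℚ) * ((((B : ℚ) / S) ^ (2 * K)) * ((2 * K + 1 : ℚ) / (((2 * K).factorial : ℚ) * (2 * K)))) : ℝ) ≤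
      (ttrigCompRem S B K : ℝ) := by
    unfold ttrigCompRem; exact_mod_cast Int.le_ceil _
  refine le_trans ?_ h4
  push_cast
  rw [mul_comm ((S : ℕ) : ℝ)]
  exact mul_le_mul_of_nonneg_right h3 hSr.le

/-- **Soundness of `tcosCompI`** (`0 < K`, `tabsI S h U ≤ S`). [cite: Joldes2011, Section 2.2.1] -/
theorem tmem_cosComp {S : ℕ} (hS : 0 < S) {h : ℚ} (h0 : 0 ≤ h) (D : ℕ) {K : ℕ} (hK : 0 < K) {u : ℝ → ℝ}
    {U : IPoly} (hu : TMem S h u U) (hB : tabsI S h U ≤ S) :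
    TMem S h (fun ρ => Real.cos (u ρ)) (tcosCompI S h D K U) := by
  intro ρ hρ
  have hW : TMem S h (fun ρ => u ρ * u ρ) (tmulI S h D U U) := tmem_mul hS h0 D hu hu
  obtain ⟨as, has, hev⟩ := tmem_horner hS h0 D hW (cosHalfCoeffs K) ρ hρ
  have hSr : (0 : ℝ) < S := by exact_mod_cast hS
  have habs := abs_le_tabsI h0 hu hρ
  have huB : |u ρ| ≤ ((tabsI S h U : ℤ) : ℝ) / S := by rw [le_div_iff₀ hSr]; exact habs
  have hu1 : |u ρ| ≤ 1 := by
    have : ((tabsI S h U : ℤ) : ℝ) ≤ S := by exact_mod_cast hB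
    exact huB.trans ((div_le_one hSr).2 this)
  have hrem := (FB.cos_sin_taylor_remainder hu1 hK).1
  rw [← eval_cosHalfCoeffs_sq] at hrem
  have hδle := trig_rem_scaled hS huB hrem
  obtain ⟨bs, hbs, hev2⟩ := exists_widen0 has hδle ρ
  refine ⟨bs, hbs, ?_⟩
  rw [hev2, ← hev]
  ring

/-- **Soundness of `tsinCompI`** (`0 < K`, `tabsI S h U ≤ S`). [cite: Joldes2011, Section 2.2.1] -/
theorem tmem_sinComp {S : ℕ} (hS : 0 < S) {h : ℚ} (h0 : 0 ≤ h) (D : ℕ) {K : ℕ} (hK : 0 < K) {u : ℝ → ℝ}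
    {U : IPoly} (hu : TMem S h u U) (hB : tabsI S h U ≤ S) :
    TMem S h (fun ρ => Real.sin (u ρ)) (tsinCompI S h D K U) := by
  intro ρ hρ
  have hW : TMem S h (fun ρ => u ρ * u ρ) (tmulI S h D U U) := tmem_mul hS h0 D hu hu
  have hP := tmem_mul hS h0 D hu (tmem_horner hS h0 D hW (sinHalfCoeffs K))
  obtain ⟨as, has, hev⟩ := hP ρ hρ
  have hSr : (0 : ℝ) < S := by exact_mod_cast hS
  have habs := abs_le_tabsI h0 hu hρ
  have huB : |u ρ| ≤ ((tabsI S h U : ℤ) : ℝ) / S := by rw [le_div_iff₀ hSr]; exact habs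
  have hu1 : |u ρ| ≤ 1 := by
    have : ((tabsI S h U : ℤ) : ℝ) ≤ S := by exact_mod_cast hB
    exact huB.trans ((div_le_one hSr).2 this)
  have hrem := (FB.cos_sin_taylor_remainder hu1 hK).2
  rw [← mul_eval_sinHalfCoeffs_sq] at hrem
  have hδle := trig_rem_scaled hS huB hrem
  obtain ⟨bs, hbs, hev2⟩ := exists_widen0 has hδle ρ
  refine ⟨bs, hbs, ?_⟩
  rw [hev2, ← hev]
  ring

/-! ### `sin ∘ g` and `cos ∘ g` -/

/-- The centred argument `u = g − c`, `c = mid0 S G`, as a Taylor model (the first step of `TMComp`).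
[cite: Joldes2011, Algorithm 2.2.8] -/
def tcentre (S : ℕ) (G : IPoly) : IPoly := tsubI G (tconst (ofRat S (mid0 S G)))

/-- Soundness of `tcentre`: `g − c ∈ tcentre S G` (the first step of `TMComp`). [cite: Joldes2011, Algorithm 2.2.8] -/
theorem tmem_centre {S : ℕ} {h : ℚ} {g : ℝ → ℝ} {G : IPoly} (hg : TMem S h g G) :
    TMem S h (fun ρ => g ρ - ((mid0 S G : ℚ) : ℝ)) (tcentre S G) :=
  tmem_sub hg (tmem_const (mem_ofRat S _))

/-- The Taylor model of `sin ∘ g` together with its acceptance flag: `c = mid0 S G`, `u = g − c`,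
`sin g = sin c · cos u + cos c · sin u`, `(cos c, sin c) ∈ cisPt S Kt kt (ofRat S c)`, `0 < K`, `|u|·S ≤ tabsI ≤ S`.
[cite: Joldes2011, Algorithm 2.2.8] -/
def tsinTM (S : ℕ) (h : ℚ) (D K Kt kt : ℕ) (G : IPoly) : IPoly × Bool :=
  let U := tcentre S G
  match cisPt S Kt kt (ofRat S (mid0 S G)) with
  | none => ([], false)
  | some E => (taddI (tsmulI S E.im (tcosCompI S h D K U)) (tsmulI S E.re (tsinCompI S h D K U)),
      decide (0 < K) && decide (tabsI S h U ≤ S))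

/-- The Taylor model of `cos ∘ g` together with its acceptance flag: `c = mid0 S G`, `u = g − c`,
`cos g = cos c · cos u − sin c · sin u`, `(cos c, sin c) ∈ cisPt S Kt kt (ofRat S c)`, `0 < K`, `|u|·S ≤ tabsI ≤ S`.
[cite: Joldes2011, Algorithm 2.2.8] -/
def tcosTM (S : ℕ) (h : ℚ) (D K Kt kt : ℕ) (G : IPoly) : IPoly × Bool :=
  let U := tcentre S G
  match cisPt S Kt kt (ofRat S (mid0 S G)) with
  | none => ([], false)
  | some E => (tsubI (tsmulI S E.re (tcosCompI S h D K U)) (tsmulI S E.im (tsinCompI S h D K U)),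
      decide (0 < K) && decide (tabsI S h U ≤ S))

/-- **Soundness of `tsinTM`.** [cite: Joldes2011, Algorithm 2.2.8] -/
theorem tmem_sin_of_tsinTM {S : ℕ} (hS : 0 < S) {h : ℚ} (h0 : 0 ≤ h) {D K Kt kt : ℕ} {g : ℝ → ℝ} {G : IPoly}
    (hg : TMem S h g G) (hok : (tsinTM S h D K Kt kt G).2 = true) :
    TMem S h (fun ρ => Real.sin (g ρ)) (tsinTM S h D K Kt kt G).1 := by
  unfold tsinTM at hok ⊢
  rcases hE : cisPt S Kt kt (ofRat S (mid0 S G)) with _ | E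
  · simp only [hE] at hok; exact absurd hok Bool.false_ne_true
  · simp only [hE, Bool.and_eq_true, decide_eq_true_eq] at hok ⊢
    obtain ⟨hK, hB⟩ := hok
    have hc := mem_ofRat S (mid0 S G)
    have hcos := mem_cos_of_cisPt hS hE hc
    have hsin := mem_sin_of_cisPt hS hE hc
    have hU := tmem_centre hg
    have hsum := tmem_add (tmem_smulI hS hsin (tmem_cosComp hS h0 D hK hU hB))
      (tmem_smulI hS hcos (tmem_sinComp hS h0 D hK hU hB))
    intro ρ hρ
    obtain ⟨as, has, hev⟩ := hsum ρ hρ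
    refine ⟨as, has, ?_⟩
    rw [← hev]
    show Real.sin (g ρ) = Real.sin ((mid0 S G : ℚ) : ℝ) * Real.cos (g ρ - ((mid0 S G : ℚ) : ℝ)) +
      Real.cos ((mid0 S G : ℚ) : ℝ) * Real.sin (g ρ - ((mid0 S G : ℚ) : ℝ))
    rw [← Real.sin_add]
    congr 1
    ring

/-- **Soundness of `tcosTM`.** [cite: Joldes2011, Algorithm 2.2.8] -/
theorem tmem_cos_of_tcosTM {S : ℕ} (hS : 0 < S) {h : ℚ} (h0 : 0 ≤ h) {D K Kt kt : ℕ} {g : ℝ → ℝ} {G : IPoly}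
    (hg : TMem S h g G) (hok : (tcosTM S h D K Kt kt G).2 = true) :
    TMem S h (fun ρ => Real.cos (g ρ)) (tcosTM S h D K Kt kt G).1 := by
  unfold tcosTM at hok ⊢
  rcases hE : cisPt S Kt kt (ofRat S (mid0 S G)) with _ | E
  · simp only [hE] at hok; exact absurd hok Bool.false_ne_true
  · simp only [hE, Bool.and_eq_true, decide_eq_true_eq] at hok ⊢
    obtain ⟨hK, hB⟩ := hok
    have hc := mem_ofRat S (mid0 S G)
    have hcos := mem_cos_of_cisPt hS hE hc
    have hsin := mem_sin_of_cisPt hS hE hc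
    have hU := tmem_centre hg
    have hdiff := tmem_sub (tmem_smulI hS hcos (tmem_cosComp hS h0 D hK hU hB))
      (tmem_smulI hS hsin (tmem_sinComp hS h0 D hK hU hB))
    intro ρ hρ
    obtain ⟨as, has, hev⟩ := hdiff ρ hρ
    refine ⟨as, has, ?_⟩
    rw [← hev]
    show Real.cos (g ρ) = Real.cos ((mid0 S G : ℚ) : ℝ) * Real.cos (g ρ - ((mid0 S G : ℚ) : ℝ)) -
      Real.sin ((mid0 S G : ℚ) : ℝ) * Real.sin (g ρ - ((mid0 S G : ℚ) : ℝ))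
    rw [← Real.cos_add]
    congr 1
    ring

end PolyMP

end Literature.Analysis.ValidatedNumerics
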